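import Literature.NumberTheory.PAdicHodge.AinfRamifiedKernel
import Literature.NumberTheory.PAdicHodge.AinfAdicComplete
import HarnessLib

/-!
# `A_inf(𝒪) = 𝔸_inf(F)[ϖ]` is `(p, ξ)`-adically complete; `ι_𝒪 : A_inf(𝒪) → B_dR⁺(F)` is injective and
# `A_inf(𝒪) ∩ Fil^k B_dR⁺ = ω^k A_inf(𝒪)`

Topic `Literature/NumberTheory/PAdicHodge`; sequel of `AinfRamifiedKernel` (`ω = ϖ − [ϖ♭]`, `ker θ_𝒪 = (ω)`) and
`AinfAdicComplete` (`𝔸_inf(F)` is `(p, ξ)`-adically complete).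

* §1 (commutative algebra) **a finite free module over an `I`-adically complete ring is `I`-adically complete**
  (`isAdicComplete_of_basis`; coordinates in a basis: `mem_smul_top_iff_of_basis`).
* §2 **`A_inf(𝒪)` is `(p, ξ)`-adically complete and separated** for the extended ideal
  `J = (p, ξ) A_inf(𝒪)` (`AinfRam.idealPXi`, `isAdicComplete_idealPXi`): it is free of rank `e` over `𝔸_inf(F)`.
* §3 ideal arithmetic: `ϖ^e ∈ p A_inf(𝒪)`, `[ϖ♭]^e ∈ J`, hence **`ω^{2e-1} ∈ J`** (so `(p, ξ)`, `(p, ω)` and `(ϖ, ω)`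
  define the same adic topology).
* §4 **`ι_𝒪(ω) = ξ_dR · unit`**, **`ι_𝒪(x) ∈ ξ_dR^k B_dR⁺ ⟹ x ∈ ω^k A_inf(𝒪)`** (`A_inf(𝒪) ∩ Fil^k = ω^k A_inf(𝒪)`, the
  analogue of `𝔸_inf ∩ Fil^k = ξ^k 𝔸_inf`), **`ι_𝒪` is injective** (`⋂ₖ ω^k A_inf(𝒪) ⊆ ⋂ₙ Jⁿ = 0`), and
  `A_inf(𝒪)` is an integral domain (a subring of `B_dR⁺(F)`); `A_inf(𝒪)/ω ≅ 𝒪_{ℂ_F}` (`quotOmegaEquiv`).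

Theorems only (plus the reviewed `AinfRam.idealPXi`, `AinfRam.quotOmegaEquiv`); no named facts, no `sorry`, no instances.
Infrastructure for hDR over a ramified base; nothing about elliptic curves is proved here.

## References
* [StacksProject] The Stacks Project, Tag 031B / Tag 0317 (completeness of finite modules over complete rings).
* [FarguesFontaine2018] L. Fargues, J.-M. Fontaine, Astérisque 406 (2018), §1.2, §2.2.
* [FontaineAsterisque223III] J.-M. Fontaine, Astérisque 223 (1994), Exp. II §1.3 (topology of `A_inf`), §1.5.2–§1.5.3
  (`B_dR⁺`, `Fil`, `A_inf ⊆ B_dR⁺`).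
-/

noncomputable section

open ValuativeRel Field Ideal WittVector Polynomial

namespace Literature.NumberTheory.PAdicHodge

open Literature.NumberTheory.GaloisRepresentations
open Literature.NumberTheory.GaloisRepresentations.IsNonarchimedeanLocalField

/-! ## §1 Finite free modules over adically complete rings -/

section FreeModule

variable {R M ι : Type*} [CommRing R] [AddCommGroup M] [Module R M] [Fintype ι]

/-- **Coordinates detect `J • M` on a free module**: `x ∈ J • M ↔` all coordinates of `x` in a basis lie in `J`.
[cite: StacksProject, Tag 031B] -/
theorem mem_smul_top_iff_of_basis (b : Module.Basis ι R M) (J : Ideal R) (x : M) :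
    x ∈ J • (⊤ : Submodule R M) ↔ ∀ i, b.repr x i ∈ J := by
  constructor
  · intro hx
    rw [← b.span_eq, Submodule.mem_ideal_smul_span_iff_exists_sum] at hx
    obtain ⟨a, ha, hsum⟩ := hx
    have hrepr : b.repr x = a := by
      rw [← hsum, ← Finsupp.linearCombination_apply, b.repr_linearCombination]
    intro i
    rw [hrepr]
    exact ha i
  · intro h
    rw [← b.sum_repr x]
    exact Submodule.sum_mem _ fun i _ => Submodule.smul_mem_smul (h i) Submodule.mem_top

/-- **A finite free module over an `I`-adically separated ring is `I`-adically separated** (coordinatewise).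
[cite: StacksProject, Tag 031B] -/
theorem isHausdorff_of_basis (b : Module.Basis ι R M) (I : Ideal R) [IsHausdorff I R] : IsHausdorff I M := by
  refine ⟨fun x hx => ?_⟩
  have hcoord : ∀ i, b.repr x i = 0 := fun i =>
    IsHausdorff.haus ‹IsHausdorff I R› _ fun n => by
      rw [SModEq.zero, smul_eq_mul, Ideal.mul_top]
      exact (mem_smul_top_iff_of_basis b (I ^ n) x).1 ((SModEq.zero).1 (hx n)) i
  have hrepr : b.repr x = 0 := Finsupp.ext hcoord
  exact (LinearEquiv.map_eq_zero_iff b.repr).1 hrepr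

/-- **A finite free module over an `I`-adically precomplete ring is `I`-adically precomplete**: limits are taken
coordinatewise in a basis. [cite: StacksProject, Tag 031B] -/
theorem isPrecomplete_of_basis (b : Module.Basis ι R M) (I : Ideal R) [IsPrecomplete I R] : IsPrecomplete I M := by
  refine ⟨fun f hf => ?_⟩
  -- each coordinate sequence is Cauchy
  have hcoord : ∀ i, ∀ {m n : ℕ}, m ≤ n → b.repr (f m) i ≡ b.repr (f n) i [SMOD (I ^ m • ⊤ : Submodule R R)] := by
    intro i m n hmn
    rw [SModEq.sub_mem, smul_eq_mul, Ideal.mul_top, ← Finsupp.sub_apply, ← map_sub]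
    exact (mem_smul_top_iff_of_basis b (I ^ m) _).1 ((SModEq.sub_mem).1 (hf hmn)) i
  choose L hL using fun i => IsPrecomplete.prec ‹IsPrecomplete I R› (hcoord i)
  refine ⟨b.equivFun.symm L, fun n => ?_⟩
  rw [SModEq.sub_mem, mem_smul_top_iff_of_basis b]
  intro i
  have h := hL i n
  rw [SModEq.sub_mem, smul_eq_mul, Ideal.mul_top] at h
  rw [map_sub, Finsupp.sub_apply]
  convert h using 2
  rw [← b.equivFun_apply, LinearEquiv.apply_symm_apply]

/-- **A finite free module over an `I`-adically complete ring is `I`-adically complete.**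
[cite: StacksProject, Tag 031B] -/
theorem isAdicComplete_of_basis (b : Module.Basis ι R M) (I : Ideal R) [IsAdicComplete I R] : IsAdicComplete I M :=
  { toIsHausdorff := isHausdorff_of_basis b I, toIsPrecomplete := isPrecomplete_of_basis b I }

end FreeModule

/-! ## §2 `A_inf(𝒪)` is `(p, ξ)`-adically complete -/

variable {F : Type} [Field F] [ValuativeRel F] [TopologicalSpace F] [IsNonarchimedeanLocalField F]
  [CharZero F] {p : ℕ} [Fact p.Prime] [Fact (¬ IsUnit (p : integerC F))]

namespace AinfRam

variable {hp : valuation F p < 1} (D : EisensteinRoot F p hp)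

/-- **The ideal `J = (p, ξ) A_inf(𝒪)`**: the extension of Fontaine's ideal of definition `(p, ξ) ⊆ 𝔸_inf(F)`.
[cite: FontaineAsterisque223III, Exp. II §1.3.1] -/
abbrev idealPXi : Ideal (AinfRam D) :=
  (Ideal.span {(p : Ainf (p := p) F), xi}).map (algebraMap (Ainf (p := p) F) (AinfRam D))

/-- `J = (p, ξ)` as a span in `A_inf(𝒪)`. [cite: FontaineAsterisque223III, Exp. II §1.3.1] -/
theorem idealPXi_eq_span :
    idealPXi D = Ideal.span {(p : AinfRam D), algebraMap (Ainf (p := p) F) (AinfRam D) xi} := by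
  rw [idealPXi, Ideal.map_span, Set.image_insert_eq, Set.image_singleton, map_natCast]

/-- `p ∈ J`. [cite: FontaineAsterisque223III, Exp. II §1.3.1] -/
theorem natCast_mem_idealPXi : (p : AinfRam D) ∈ idealPXi D := by
  rw [idealPXi_eq_span]; exact Ideal.subset_span (Set.mem_insert _ _)

/-- `ξ ∈ J`. [cite: FontaineAsterisque223III, Exp. II §1.3.1] -/
theorem algebraMap_xi_mem_idealPXi : algebraMap (Ainf (p := p) F) (AinfRam D) xi ∈ idealPXi D := by
  rw [idealPXi_eq_span]; exact Ideal.subset_span (Set.mem_insert_of_mem _ rfl)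

variable [IsAdicComplete (Ideal.span {(p : integerC F)}) (integerC F)]

/-- **`A_inf(𝒪)` is `(p, ξ)`-adically complete and separated** (free of rank `e` over the `(p, ξ)`-adically
complete `𝔸_inf(F)`, tree `isAdicComplete_span_p_xi`). [cite: FontaineAsterisque223III, Exp. II §1.3.2]
[cite: FarguesFontaine2018, §1.2] -/
theorem isAdicComplete_idealPXi : IsAdicComplete (idealPXi D) (AinfRam D) := by
  haveI : IsAdicComplete (Ideal.span {(p : Ainf (p := p) F), xi}) (Ainf (p := p) F) := isAdicComplete_span_p_xi
  haveI : IsAdicComplete (Ideal.span {(p : Ainf (p := p) F), xi}) (AinfRam D) :=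
    isAdicComplete_of_basis (powerBasis D).basis _
  exact (IsAdicComplete.map_algebraMap_iff (Ideal.span {(p : Ainf (p := p) F), xi}) (AinfRam D)).2 inferInstance

/-- `A_inf(𝒪)` is `(p, ξ)`-adically separated: `⋂ₙ Jⁿ = 0`. [cite: FontaineAsterisque223III, Exp. II §1.3.2] -/
theorem eq_zero_of_forall_mem_idealPXi_pow {x : AinfRam D} (h : ∀ n : ℕ, x ∈ idealPXi D ^ n) : x = 0 := by
  haveI := isAdicComplete_idealPXi D
  refine IsHausdorff.haus (IsAdicComplete.toIsHausdorff (I := idealPXi D)) x fun n => ?_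
  rw [SModEq.zero, smul_eq_mul, Ideal.mul_top]
  exact h n

/-! ## §3 `ϖ^e ∈ (p)`, `[ϖ♭]^e ∈ J`, `ω^{2e-1} ∈ J` -/

omit [IsAdicComplete (Ideal.span {(p : integerC F)}) (integerC F)] in
/-- **`ϖ^e ∈ p · A_inf(𝒪)`**: `ϖ^e = -(c₀ + ⋯ + c_{e-1}ϖ^{e-1})` with `p ∣ cᵢ` (Eisenstein).
[cite: SerreLocalFields1979, Ch. I §6 Prop. 17] -/
theorem varpi_pow_mem_span_natCast : varpi D ^ D.e ∈ Ideal.span {(p : AinfRam D)} := by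
  have h := eval₂_varpi' D
  rw [Polynomial.eval₂_eq_sum_range, Finset.sum_range_succ, ← D.e_def,
    show D.poly.coeff D.e = 1 from D.monic, map_one, one_mul] at h
  rw [eq_neg_of_add_eq_zero_right h]
  refine (Ideal.neg_mem_iff _).2 (Ideal.sum_mem _ fun i hi => ?_)
  obtain ⟨d, hd⟩ := D.dvd_coeff (Finset.mem_range.1 hi)
  rw [hd, map_mul, map_natCast, mul_assoc]
  exact Ideal.mul_mem_right _ _ (Ideal.mem_span_singleton_self _)

omit [IsAdicComplete (Ideal.span {(p : integerC F)}) (integerC F)] in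
/-- `ϖ^e ∈ J`. [cite: SerreLocalFields1979, Ch. I §6 Prop. 17] -/
theorem varpi_pow_mem_idealPXi : varpi D ^ D.e ∈ idealPXi D :=
  (Ideal.span_singleton_le_iff_mem _).2 (natCast_mem_idealPXi D) (varpi_pow_mem_span_natCast D)

/-- **`[ϖ♭]^e ∈ J`**: `[ϖ♭]^e = [(ϖ♭)^e] = [p♭]·[u] = (ξ + p)·[u]`. [cite: FarguesFontaine2018, §2.2] -/
theorem algebraMap_teichmuller_rootFlat_pow_mem_idealPXi :
    algebraMap (Ainf (p := p) F) (AinfRam D) (teichmuller p D.rootFlat) ^ D.e ∈ idealPXi D := by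
  obtain ⟨u, hu⟩ := D.exists_rootFlat_pow_eq_pFlat_mul
  have h1 : teichmuller p (pFlat : PreTilt (integerC F) p) = (xi : Ainf (p := p) F) + p := by rw [xi_def, sub_add_cancel]
  rw [← map_pow, ← map_pow, hu, map_mul, h1, map_mul, map_add, map_natCast]
  exact Ideal.mul_mem_right _ _ (Ideal.add_mem _ (algebraMap_xi_mem_idealPXi D) (natCast_mem_idealPXi D))

/-- **`ω^{2e-1} ∈ J = (p, ξ) A_inf(𝒪)`** (binomial expansion of `(ϖ − [ϖ♭])^{2e-1}`: each monomial contains `ϖ^e` or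
`[ϖ♭]^e`). Hence `(p, ξ)`, `(p, ω)` and `(ϖ, ω)` generate the same adic topology on `A_inf(𝒪)`.
[cite: FarguesFontaine2018, §1.2] -/
theorem omega_pow_mem_idealPXi : omega D ^ (D.e + D.e - 1) ∈ idealPXi D := by
  rw [omega_def, sub_eq_add_neg]
  refine Ideal.add_pow_add_pred_mem_of_pow_mem _ (varpi_pow_mem_idealPXi D) ?_
  rw [neg_pow]
  exact Ideal.mul_mem_left _ _ (algebraMap_teichmuller_rootFlat_pow_mem_idealPXi D)

/-- `ω^{(2e-1)n} ∈ Jⁿ`. [cite: FarguesFontaine2018, §1.2] -/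
theorem omega_pow_mul_mem_idealPXi_pow (n : ℕ) : omega D ^ ((D.e + D.e - 1) * n) ∈ idealPXi D ^ n := by
  rw [pow_mul]; exact Ideal.pow_mem_pow (omega_pow_mem_idealPXi D) n

/-- **`⋂ₖ ω^k A_inf(𝒪) = 0`**: an element divisible by every power of `ω` lies in every power of `J`, hence is `0`.
[cite: FontaineAsterisque223III, Exp. II §1.3.2] -/
theorem eq_zero_of_forall_omega_pow_dvd {x : AinfRam D} (h : ∀ k : ℕ, omega D ^ k ∣ x) : x = 0 :=
  eq_zero_of_forall_mem_idealPXi_pow D fun n => by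
    obtain ⟨c, hc⟩ := h ((D.e + D.e - 1) * n)
    rw [hc]
    exact Ideal.mul_mem_right _ _ (omega_pow_mul_mem_idealPXi_pow D n)

/-! ## §4 `ι_𝒪` is injective and `A_inf(𝒪) ∩ Fil^k = ω^k A_inf(𝒪)` -/

/-- `ι_𝒪(ξ) = ξ_dR`. [cite: FontaineAsterisque223III, Exp. II §1.5.2] -/
theorem toBdR_xi (hF : Function.Surjective (fontaineTheta (integerC F) p)) :
    toBdR D hF (algebraMap (Ainf (p := p) F) (AinfRam D) xi) = xiBdR := by
  rw [toBdR_algebraMap]; rfl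

/-- **`ι_𝒪(ω) = ξ_dR · v` with `v` a unit of `B_dR⁺(F)`**: `ω ∣ ξ` in `A_inf(𝒪)` and `ι_𝒪(ω) ∈ ker θ_dR = ξ_dR B_dR⁺`.
[cite: FarguesFontaine2018, §2.2] [cite: FontaineAsterisque223III, Exp. II §1.5.2] -/
theorem exists_unit_toBdR_omega_eq (hF : Function.Surjective (fontaineTheta (integerC F) p)) :
    ∃ v : (BDeRhamPlus (integerC F) p)ˣ, toBdR D hF (omega D) = (xiBdR : BDeRhamPlus (integerC F) p) * (v : BDeRhamPlus (integerC F) p) := by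
  obtain ⟨c, hc⟩ := omega_dvd_xi D
  obtain ⟨d, hd⟩ := Ideal.mem_span_singleton'.1 (toBdR_mem_span_xiBdR D hF (theta_omega D))
  have h1 : xiBdR * (d * toBdR D hF c - 1) = 0 := by
    rw [mul_sub, mul_one, ← mul_assoc, mul_comm xiBdR d, hd, ← map_mul, ← hc, toBdR_xi, sub_self]
  have h2 : d * toBdR D hF c = 1 := sub_eq_zero.1 (eq_zero_of_xiBdR_mul_eq_zero h1)
  exact ⟨Units.mkOfMulEqOne d _ h2, by rw [Units.val_mkOfMulEqOne, mul_comm]; exact hd.symm⟩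

/-- `ι_𝒪(x) ∈ ξ_dR B_dR⁺ ⟹ θ_𝒪(x) = 0`. [cite: FontaineAsterisque223III, Exp. II §1.5.2] -/
theorem theta_eq_zero_of_toBdR_mem_span (hF : Function.Surjective (fontaineTheta (integerC F) p)) {x : AinfRam D}
    (hx : toBdR D hF x ∈ Ideal.span {(xiBdR : BDeRhamPlus (integerC F) p)}) : theta D x = 0 := by
  have h0 : ((theta D x : integerC F) : CompletedAlgClosure F) = 0 := by
    rw [← thetaBdR_toBdR D hF]; exact (mem_ker_thetaBdR_iff _).2 hx
  exact Subtype.ext h0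

/-- **`A_inf(𝒪) ∩ Fil^k B_dR⁺ = ω^k A_inf(𝒪)`**: if `ι_𝒪(x) ∈ ξ_dR^k B_dR⁺` then `ω^k ∣ x` (induction on `k`, peeling off
one factor `ω ↦ ξ_dR·unit` at a time; the analogue of `𝔸_inf ∩ Fil^k = ξ^k 𝔸_inf`).
[cite: FontaineAsterisque223III, Exp. II §1.5.3] [cite: FarguesFontaine2018, §2.2] -/
theorem omega_pow_dvd_of_toBdR_mem_span_pow (hF : Function.Surjective (fontaineTheta (integerC F) p)) :
    ∀ (k : ℕ) {x : AinfRam D}, toBdR D hF x ∈ Ideal.span {(xiBdR : BDeRhamPlus (integerC F) p) ^ k} → omega D ^ k ∣ x := by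
  obtain ⟨v, hv⟩ := exists_unit_toBdR_omega_eq D hF
  intro k
  induction k with
  | zero => intro x _; rw [pow_zero]; exact one_dvd _
  | succ k ih =>
    intro x hx
    have hx1 : toBdR D hF x ∈ Ideal.span {(xiBdR : BDeRhamPlus (integerC F) p)} :=
      Ideal.span_singleton_le_span_singleton.2 (dvd_pow_self _ k.succ_ne_zero) hx
    obtain ⟨y, rfl⟩ := omega_dvd_of_theta_eq_zero D (theta_eq_zero_of_toBdR_mem_span D hF hx1)
    obtain ⟨w, hw⟩ := Ideal.mem_span_singleton'.1 hx
    rw [map_mul, hv] at hw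
    have h1 : xiBdR * ((v : BDeRhamPlus (integerC F) p) * toBdR D hF y - xiBdR ^ k * w) = 0 := by
      rw [mul_sub, ← mul_assoc, ← hw]; ring
    have h2 : (v : BDeRhamPlus (integerC F) p) * toBdR D hF y = xiBdR ^ k * w :=
      sub_eq_zero.1 (eq_zero_of_xiBdR_mul_eq_zero h1)
    have h3 : toBdR D hF y ∈ Ideal.span {(xiBdR : BDeRhamPlus (integerC F) p) ^ k} := by
      rw [Ideal.mem_span_singleton, ← Units.dvd_mul_left (u := v), h2]
      exact dvd_mul_right _ _
    obtain ⟨z, rfl⟩ := ih h3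
    exact ⟨z, by ring⟩

/-- **`ι_𝒪 : A_inf(𝒪) → B_dR⁺(F)` is injective** (`ι_𝒪(x) = 0 ⟹ ω^k ∣ x` for all `k` `⟹ x ∈ ⋂ₙ Jⁿ = 0`).
[cite: FontaineAsterisque223III, Exp. II §1.5.3] -/
theorem toBdR_injective (hF : Function.Surjective (fontaineTheta (integerC F) p)) : Function.Injective (toBdR D hF) :=
  (injective_iff_map_eq_zero _).2 fun x hx =>
    eq_zero_of_forall_omega_pow_dvd D fun k =>
      omega_pow_dvd_of_toBdR_mem_span_pow D hF k (by rw [hx]; exact Submodule.zero_mem _)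

/-- `ι_𝒪(x) = 0 ↔ x = 0`. [cite: FontaineAsterisque223III, Exp. II §1.5.3] -/
theorem toBdR_eq_zero_iff (hF : Function.Surjective (fontaineTheta (integerC F) p)) (x : AinfRam D) :
    toBdR D hF x = 0 ↔ x = 0 :=
  map_eq_zero_iff _ (toBdR_injective D hF)

/-- **`A_inf(𝒪)` is an integral domain** (a subring of the domain `B_dR⁺(F)` via `ι_𝒪`).
[cite: FarguesFontaine2018, §1.2] -/
theorem isDomain (hF : Function.Surjective (fontaineTheta (integerC F) p)) : IsDomain (AinfRam D) := by
  haveI := isDomain_bDeRhamPlus (F := F) (p := p) hF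
  exact Function.Injective.isDomain (toBdR D hF) (toBdR_injective D hF)

/-- `ω ≠ 0`. [cite: FarguesFontaine2018, §2.2] -/
theorem omega_ne_zero (hF : Function.Surjective (fontaineTheta (integerC F) p)) : omega D ≠ 0 := fun h => by
  haveI := isDomain_bDeRhamPlus (F := F) (p := p) hF
  obtain ⟨c, hc⟩ := omega_dvd_xi D
  rw [h, zero_mul] at hc
  have hxi : (xiBdR : BDeRhamPlus (integerC F) p) = 0 := by rw [← toBdR_xi D hF, hc, map_zero]
  exact one_ne_zero (eq_zero_of_xiBdR_mul_eq_zero (x := (1 : BDeRhamPlus (integerC F) p)) (by rw [hxi, zero_mul]))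

/-- `ω` is a non-zero-divisor of `A_inf(𝒪)`: `ω x = 0 ⟹ x = 0`. [cite: FarguesFontaine2018, §2.2] -/
theorem eq_zero_of_omega_mul_eq_zero (hF : Function.Surjective (fontaineTheta (integerC F) p)) {x : AinfRam D}
    (h : omega D * x = 0) : x = 0 := by
  haveI := isDomain D hF
  exact (mul_eq_zero.1 h).resolve_left (omega_ne_zero D hF)

/-- **`A_inf(𝒪)/ω ≅ 𝒪_{ℂ_F}`** via `θ_𝒪` (surjective with kernel `(ω)`): `ω` is an untilt-defining primitive element.
[cite: FarguesFontaine2018, §2.2 (Cor. 2.2.8)] -/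
def quotOmegaEquiv (hθ : Function.Surjective (fontaineTheta (integerC F) p)) :
    AinfRam D ⧸ Ideal.span {omega D} ≃+* integerC F :=
  (Ideal.quotEquivOfEq (ker_theta_eq_span_omega D).symm).trans
    (RingHom.quotientKerEquivOfSurjective (theta_surjective D hθ))

/-- `quotOmegaEquiv` is induced by `θ_𝒪`. [cite: FarguesFontaine2018, §2.2 (Cor. 2.2.8)] -/
theorem quotOmegaEquiv_mk (hθ : Function.Surjective (fontaineTheta (integerC F) p)) (x : AinfRam D) :
    quotOmegaEquiv D hθ (Ideal.Quotient.mk _ x) = theta D x := rfl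

end AinfRam

end Literature.NumberTheory.PAdicHodge

end
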